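import Summits.BirchSwinnertonDyer.BirchSwinnertonDyer.Theorems.AlignedTransportAtTwoMainConjectureOfRankZeroBSDAtTwoHalfDescentLayerIndexCertificateSelmer
import HarnessLib

/-!
# Route `AlignedTransportAtTwo`, crux C2 `MainConjectureOfRankZeroBSDAtTwo` (stmt-BirchSwinnertonDyer-22298):
# THE DESCENT NUMBER WITHOUT GREENBERG 4.14, VII — THE CERTIFICATE IS COMPLETE: for EVERY finitely generated torsion `Λ`-module `X`,
# `μ(X) = 0 ⟺ ∃ n, 0 < #(X/Ψ_n X) < p^{pⁿ(p−1)}`; in Selmer currency, for EVERY dual datum with `X` f.g. torsion,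
# `μ(X(E/K_∞)) = 0 ⟺` SOME relative-norm kernel `ker(N_n | Sel_{p^∞}(E/K_∞))` is finite of order `< p^{pⁿ(p−1)}` — Greenberg's `μ = 0` as ONE small descent number

HONEST FRAMING (cell `bsd-f1-sign2`, WIDTH-5 attached prover seat `bsd-line-att-p5` gen 55 on line `birth` of the lead `bsd-line-att-p2`;
`--supports` stmt-BirchSwinnertonDyer-22298, closes nothing; BSD is NOT proved by any of this; the crux C2, its verdict «blocked-on
`Rank1Residual.GreenbergMuConjectureIrreducible`» and every registered stub (P / T / Kμ / LimDoor / MuIneqʳ / PFμ⁺) are untouched). THEOREMS ONLY — no `def`,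
no instance, no named fact, no `sorry`; route-independent (any prime `p`, any number field, any `ℤ_p`-extension). Sequel of this gen's `…HalfDescentLayerIndexFinite`
(`#(X/Ψ_nX) = p^{φμ+λ}·#(F/Ψ_nF)`, `F` the largest finite submodule) and `…HalfDescentLayerIndexCertificate{,Selmer}` (`0 < #(X/Ψ_nX) < p^{φ} ⟹ μ = 0`,
hypothesis-free). THIS FILE proves the converse: if `μ = 0` the certificate EXISTS (at the layer `n = λ + #F`, say), so the one-sided certificate of files III–IV
is in fact a CRITERION.

* §1 (pure `Λ`) ★★★ **`mu_eq_zero_iff_exists_natCard_layerQuotient_pos_lt`: `μ(f) = 0 ⟺ ∃ n, 0 < #(X/Ψ_n X) < p^{pⁿ(p−1)}`** (`X` ANY f.g. torsion, `char_Λ X = (f)`);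
  ★★★ `muInvariant_eq_zero_iff_exists_natCard_layerQuotient_pos_lt` (the same with `μ(X)`, generator hidden). `⟹`: with `μ = 0` the index is `p^{λ}·#(F/Ψ_nF) ≤
  p^{λ}·#F < p^{λ + #F} ≤ p^{pⁿ(p−1)}` at `n = λ + #F`; `⟸`: file III.
* §2 (Selmer) ★★★ **`mu_eq_zero_iff_exists_natCard_endInvariants_relNorm_pos_lt`: `μ(X(E/K_∞)) = 0 ⟺ ∃ n, 0 < #ker(N_n | Sel_{p^∞}(E/K_∞)) < p^{pⁿ(p−1)}`**
  (`N_n = ∑_{i<p}(conj_γ^{pⁿ})^i`; `D` any dual datum with `X` f.g. torsion).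
Reading for C2 (`p = 2`): on the seed cell, Greenberg's conjecture «`μ₂(X(W/ℚ_∞)) = 0`» — the crux's only non-print input — is EQUIVALENT to «for some `n`, the
kernel of `1 + conj_γ^{2ⁿ}` on `Sel_{2^∞}(W/ℚ_∞)` is finite of order `< 2^{2ⁿ}`»; files V/VI turn the right side into Mazur's main conjecture given `BSD(W,2)` + PRINT.
Nothing is computed for any curve. Memo `Cruxes/MainConjectureOfRankZeroBSDAtTwo/LAYER-INDEX-FINITE-att-p5-g55.md`.

References: R. Greenberg, LNM 1716 (1999), §1 pp. 60–65, Conj. 1.11, §4 p. 117 [GreenbergLNM1716]; L. Washington, GTM 83, §13.3 Thm. 13.13 [Washington1997];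
J. Neukirch, A. Schmidt, K. Wingberg, (5.3.1), (5.3.17) [NeukirchSchmidtWingberg2008].
-/

set_option linter.dupNamespace false
set_option autoImplicit false

noncomputable section

open scoped Classical AddSubgroup Polynomial

universe u

namespace Summit.BirchSwinnertonDyer.BirchSwinnertonDyer.Theorems.AlignedTransportAtTwoHalfDescentLayerIndexCriterion

open WeierstrassCurve Literature.NumberTheory.EllipticCurves Literature.NumberTheory.EllipticCurves.IwasawaDual
  Literature.NumberTheory.EllipticCurves.IwasawaAlgebra
  Summit.BirchSwinnertonDyer.Rank1Residual.X1.MuLambda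
  Summit.BirchSwinnertonDyer.Rank1Residual.X1.GeneratorBoundMu
  Summit.BirchSwinnertonDyer.Rank1Residual.Iwasawa
  Summit.BirchSwinnertonDyer.BirchSwinnertonDyer.Theorems.DefectPrime
  Summit.BirchSwinnertonDyer.BirchSwinnertonDyer.Theorems.AlignedTransportAtTwoCyclotomicLayerPrime
  Summit.BirchSwinnertonDyer.BirchSwinnertonDyer.Theorems.AlignedTransportAtTwoHalfDescentLayerIndex
  Summit.BirchSwinnertonDyer.BirchSwinnertonDyer.Theorems.AlignedTransportAtTwoHalfDescentLayerIndexFinite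
  Summit.BirchSwinnertonDyer.BirchSwinnertonDyer.Theorems.AlignedTransportAtTwoHalfDescentLayerIndexSelmer
  Summit.BirchSwinnertonDyer.BirchSwinnertonDyer.Theorems.AlignedTransportAtTwoHalfDescentLayerIndexCertificate
  Summit.BirchSwinnertonDyer.BirchSwinnertonDyer.Theorems.AlignedTransportAtTwoHalfDescentLayerIndexCertificateSelmer

/-! ## §1 `μ = 0 ⟺` some layer quotient is finite of order `< p^{pⁿ(p−1)}` -/

section Module

variable {p : ℕ} [hp : Fact p.Prime] {M : Type u} [AddCommGroup M] [Module (IwasawaAlgebra p) M]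

/-- ★★★ **GREENBERG'S `μ = 0` IS THE EXISTENCE OF ONE SMALL LAYER QUOTIENT.** For EVERY finitely generated torsion `Λ`-module `X` with `char_Λ X = (f)`:
**`μ(f) = 0 ⟺ ∃ n, 0 < #(X/Ψ_n X) < p^{pⁿ(p−1)}`** (`Ψ_n = Φ_{p^{n+1}}(1+T)`). `⟸` is the hypothesis-free certificate (file III); `⟹`: at `n = λ(f) + #F` (`F` the
largest finite submodule) the index is `p^{λ}·#(F/Ψ_nF) ≤ p^{λ}·#F < p^{n} ≤ p^{pⁿ(p−1)}`. [cite: Washington1997, §13.3 Thm. 13.13] [cite: GreenbergLNM1716, Conj. 1.11]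
[cite: NeukirchSchmidtWingberg2008, (5.3.17)] -/
theorem mu_eq_zero_iff_exists_natCard_layerQuotient_pos_lt [Module.Finite (IwasawaAlgebra p) M] (hM : Module.IsTorsion (IwasawaAlgebra p) M)
    {f : IwasawaAlgebra p} (hchar : Literature.NumberTheory.EllipticCurves.Module.charIdeal (IwasawaAlgebra p) M = Ideal.span {f}) :
    mu f = 0 ↔ ∃ n : ℕ,
      0 < Nat.card (M ⧸ (Ideal.span {(((Polynomial.cyclotomic (p ^ (n + 1)) ℤ_[p]).comp (Polynomial.X + 1) : ℤ_[p][X]) : IwasawaAlgebra p)} • ⊤ :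
        Submodule (IwasawaAlgebra p) M)) ∧
      Nat.card (M ⧸ (Ideal.span {(((Polynomial.cyclotomic (p ^ (n + 1)) ℤ_[p]).comp (Polynomial.X + 1) : ℤ_[p][X]) : IwasawaAlgebra p)} • ⊤ :
        Submodule (IwasawaAlgebra p) M)) < p ^ (p ^ n * (p - 1)) := by
  refine ⟨fun hμ ↦ ?_, fun ⟨n, hpos, hlt⟩ ↦ mu_eq_zero_of_natCard_layerQuotient_pos_lt hM hchar hpos hlt⟩
  haveI : IsNoetherian (IwasawaAlgebra p) M := inferInstance
  obtain ⟨F, hFfin, hFmax⟩ := exists_finite_submodule_forall_finite_le (R := IwasawaAlgebra p) (M := M)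
  haveI : Finite F := hFfin
  have hF := forall_finite_eq_bot_quotient_of_forall_finite_le F hFmax
  -- the layer `n = λ + #F`
  set c : ℕ := Nat.card F with hc
  have hcpos : 0 < c := Nat.card_pos
  set n : ℕ := lam f + c with hn
  have hpn : n < p ^ n := Nat.lt_pow_self hp.out.one_lt
  have hφ : p ^ n ≤ p ^ n * (p - 1) := Nat.le_mul_of_pos_right _ (by have := hp.out.two_le; omega)
  have hlam : lam f < p ^ n * (p - 1) := by omega
  refine ⟨n, ?_, ?_⟩
  · haveI := (pow_dvd_natCard_layerQuotient hM hchar hlam).2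
    exact Nat.card_pos
  · haveI : Finite (F ⧸ (Ideal.span {(((Polynomial.cyclotomic (p ^ (n + 1)) ℤ_[p]).comp (Polynomial.X + 1) : ℤ_[p][X]) : IwasawaAlgebra p)} • ⊤ :
        Submodule (IwasawaAlgebra p) F)) := Finite.of_surjective _ (Submodule.mkQ_surjective _)
    rw [natCard_layerQuotient_eq_pow_mul hM F hF hchar hlam, hμ, mul_zero, zero_add]
    have hquot : Nat.card (F ⧸ (Ideal.span {(((Polynomial.cyclotomic (p ^ (n + 1)) ℤ_[p]).comp (Polynomial.X + 1) : ℤ_[p][X]) : IwasawaAlgebra p)} • ⊤ :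
        Submodule (IwasawaAlgebra p) F)) ≤ c := Nat.card_le_card_of_surjective _ (Submodule.mkQ_surjective _)
    have hcp : c < p ^ c := Nat.lt_pow_self hp.out.one_lt
    calc p ^ lam f * Nat.card (F ⧸ (Ideal.span {(((Polynomial.cyclotomic (p ^ (n + 1)) ℤ_[p]).comp (Polynomial.X + 1) : ℤ_[p][X]) : IwasawaAlgebra p)} • ⊤ :
            Submodule (IwasawaAlgebra p) F))
        ≤ p ^ lam f * c := Nat.mul_le_mul_left _ hquot
      _ < p ^ lam f * p ^ c := Nat.mul_lt_mul_of_pos_left hcp (pow_pos hp.out.pos _)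
      _ = p ^ n := by rw [← pow_add]
      _ ≤ p ^ (p ^ n * (p - 1)) := Nat.pow_le_pow_right hp.out.pos (hpn.le.trans hφ)

/-- ★★★ **`μ(X) = 0 ⟺ ∃ n, 0 < #(X/Ψ_n X) < p^{pⁿ(p−1)}`** for EVERY finitely generated torsion `Λ`-module `X` (`μ(X)` the `μ`-invariant of the module; the characteristic
ideal is principal with a non-zero generator `f`, and `μ(X) = μ(f)`). [cite: Washington1997, §13.2–13.3] [cite: GreenbergLNM1716, Conj. 1.11] -/
theorem muInvariant_eq_zero_iff_exists_natCard_layerQuotient_pos_lt [Module.Finite (IwasawaAlgebra p) M] (hM : Module.IsTorsion (IwasawaAlgebra p) M) :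
    muInvariant p M = 0 ↔ ∃ n : ℕ,
      0 < Nat.card (M ⧸ (Ideal.span {(((Polynomial.cyclotomic (p ^ (n + 1)) ℤ_[p]).comp (Polynomial.X + 1) : ℤ_[p][X]) : IwasawaAlgebra p)} • ⊤ :
        Submodule (IwasawaAlgebra p) M)) ∧
      Nat.card (M ⧸ (Ideal.span {(((Polynomial.cyclotomic (p ^ (n + 1)) ℤ_[p]).comp (Polynomial.X + 1) : ℤ_[p][X]) : IwasawaAlgebra p)} • ⊤ :
        Submodule (IwasawaAlgebra p) M)) < p ^ (p ^ n * (p - 1)) := by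
  obtain ⟨f, hf0, hchar⟩ := exists_charGenerator_ne_zero M hM
  rw [← Summit.BirchSwinnertonDyer.Rank1Residual.X1.MuPart.mu_generator_eq_muInvariant M hM hf0 hchar]
  exact mu_eq_zero_iff_exists_natCard_layerQuotient_pos_lt hM hchar

end Module

/-! ## §2 Selmer currency: `μ(X(E/K_∞)) = 0 ⟺` some relative-norm kernel is finite of order `< p^{pⁿ(p−1)}` -/

section Selmer

variable {K : Type u} [Field K] [NumberField K] (W : WeierstrassCurve K) {p : ℕ} [hp : Fact p.Prime] (κ : ZpExtension K p)
  {γ : Field.absoluteGaloisGroup K}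

/-- ★★★ **GREENBERG'S `μ = 0` FOR `Sel_{p^∞}(E/K_∞)` IS ONE SMALL RELATIVE-NORM KERNEL.** `E/K`, `κ` any `ℤ_p`-extension with topological generator `γ`, `D` any
Pontryagin-dual datum whose `X` is finitely generated torsion. Then
**`μ(X(E/K_∞)) = 0 ⟺ ∃ n, 0 < #{s ∈ Sel_{p^∞}(E/K_∞) : N_n s = 0} < p^{pⁿ(p−1)}`**, `N_n = ∑_{i<p}(conj_γ^{pⁿ})^i` the relative norm of `K_{n+1}/K_n`.
[cite: GreenbergLNM1716, Conj. 1.11 and §1 pp. 60–65] [cite: Washington1997, §13.3 Thm. 13.13] -/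
theorem mu_eq_zero_iff_exists_natCard_endInvariants_relNorm_pos_lt (hγ : κ.IsTopGenerator γ) (D : W.SelmerDualData κ γ)
    [Module.Finite (IwasawaAlgebra p) D.X] (hD : D.IsTorsion) :
    D.mu = 0 ↔ ∃ n : ℕ, 0 < Nat.card ↥(endInvariants (∑ i ∈ Finset.range p, ((W.conjSelmerInfty κ γ) ^ (p ^ n)) ^ i)) ∧
      Nat.card ↥(endInvariants (∑ i ∈ Finset.range p, ((W.conjSelmerInfty κ γ) ^ (p ^ n)) ^ i)) < p ^ (p ^ n * (p - 1)) := by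
  simp only [← natCard_layerQuotient_cyclotomic_eq_natCard_endInvariants W κ hγ D]
  exact muInvariant_eq_zero_iff_exists_natCard_layerQuotient_pos_lt (M := D.X) hD

end Selmer

end Summit.BirchSwinnertonDyer.BirchSwinnertonDyer.Theorems.AlignedTransportAtTwoHalfDescentLayerIndexCriterion

end
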